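import Summits.CriticalPhenomena.PercolationContinuityZ3.Theorems.PercNearOneGluingNoHeavyPcintMemUniformTenData
import HarnessLib

/-!
# CriticalPhenomena/PercolationContinuityZ3 — Theorems/PercNearOneGluingNoHeavyPcintMemUniformTenStructC.lean: fast structural check of rows 3072–4607 of the memory-10 list (kernel)

Lane prim-pcint, STRUCTURE rule (prim-pcint-2 GEN 19).  `URowsOKF u10tab 10 6192 lo 192 = true` for the 192-row ranges of rows 3072–4607, each by one
`decide +kernel` (tuple-model check of …MemUniformChunkFast: every recorded successor is `mstep 10` of the row state up to the recorded
symmetry, indices `< 6192`), assembled as `structRows10C : URowsOKC perm6 u10tab 10 6192 3072 4608` by `urowsOKC_of_fast` + `permsOK_perm6`.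
Generated by numerics/emit_u10struct.py.

HONEST FRAMING: kernel evaluation of a finite check.  No `sorry`; standard axioms.  Written by prim-pcint-2 gen 19, 2026-08-26.
-/

namespace Summit.CriticalPhenomena.PercolationContinuityZ3.Theorems.Pcint

open Literature.Probability.Percolation Literature.Probability.LatticeModels

/-- Fast structural check of rows 3072–3263. [folklore] -/
theorem struct10_16 : URowsOKF u10tab 10 6192 3072 192 = true := by
  decide +kernel

/-- Fast structural check of rows 3264–3455. [folklore] -/
theorem struct10_17 : URowsOKF u10tab 10 6192 3264 192 = true := by
  decide +kernel

/-- Fast structural check of rows 3456–3647. [folklore] -/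
theorem struct10_18 : URowsOKF u10tab 10 6192 3456 192 = true := by
  decide +kernel

/-- Fast structural check of rows 3648–3839. [folklore] -/
theorem struct10_19 : URowsOKF u10tab 10 6192 3648 192 = true := by
  decide +kernel

/-- Fast structural check of rows 3840–4031. [folklore] -/
theorem struct10_20 : URowsOKF u10tab 10 6192 3840 192 = true := by
  decide +kernel

/-- Fast structural check of rows 4032–4223. [folklore] -/
theorem struct10_21 : URowsOKF u10tab 10 6192 4032 192 = true := by
  decide +kernel

/-- Fast structural check of rows 4224–4415. [folklore] -/
theorem struct10_22 : URowsOKF u10tab 10 6192 4224 192 = true := by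
  decide +kernel

/-- Fast structural check of rows 4416–4607. [folklore] -/
theorem struct10_23 : URowsOKF u10tab 10 6192 4416 192 = true := by
  decide +kernel

/-- **Rows 3072–4607 of the memory-10 list are structurally valid.** [folklore] -/
theorem structRows10C : URowsOKC perm6 u10tab 10 6192 3072 4608 :=
  (urowsOKC_append perm6 u10tab (urowsOKC_append perm6 u10tab (urowsOKC_append perm6 u10tab (urowsOKC_append perm6 u10tab (urowsOKC_append perm6 u10tab (urowsOKC_append perm6 u10tab (urowsOKC_append perm6 u10tab (urowsOKC_of_fast u10tab permsOK_perm6 struct10_16) (urowsOKC_of_fast u10tab permsOK_perm6 struct10_17)) (urowsOKC_of_fast u10tab permsOK_perm6 struct10_18)) (urowsOKC_of_fast u10tab permsOK_perm6 struct10_19)) (urowsOKC_of_fast u10tab permsOK_perm6 struct10_20)) (urowsOKC_of_fast u10tab permsOK_perm6 struct10_21)) (urowsOKC_of_fast u10tab permsOK_perm6 struct10_22)) (urowsOKC_of_fast u10tab permsOK_perm6 struct10_23))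

end Summit.CriticalPhenomena.PercolationContinuityZ3.Theorems.Pcint
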